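import Mathlib
import Summits.Ventures.PercRepro2.RootCutDefs

/-!
# Two-root cuts: events on `Q` factorise across the root pair
(blind cell PercRepro2, night-1 g32; proofs/NIGHT1-G32.md §6, the root-shield identity)

On `Q = {a₁ ↮ a₂}` a connection between two vertices of one side is decided inside that side
(`conn_iff_restrict_R_of_not_conn`, the `R`-side version of the path lemma), so
`Q ∩ {u ↔ v} ∩ {u' ↔ v'}` with `u, v` on the `R`-side and `u', v'` on the `S`-side is the
intersection of the two side events `Q_R ∩ {u ↔ v}_R` and `Q_S ∩ {u' ↔ v'}_S`
(`avoidAll_inter_conn_conn_eq`), and its probability is the product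
(`prob_avoidAll_inter_conn_conn_eq_mul`); the one-sided versions give the constants
`κ = [P_R(Q_R, o ↔ a₁) − P_R(Q_R, o ↔ a₂)] / P_R(Q_R)` of the root-shield identity.
Standard axioms.
-/

namespace Summit.Ventures.PercRepro2.RootCut

open CutV

variable {V : Type*} {E : Type*} {ends : E → Sym2 V} {a₁ a₂ : V} {VR VS : Set V} {ER ES : Set E}
  [DecidablePred (· ∈ ER)] [DecidablePred (· ∈ ES)]

/-- **Path lemma on `Q_S`, `R`-side**: for `u, v ∈ VR ∪ {a₁, a₂}`, when the roots are not joined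
inside `S`, `u ↔ v` in `ω` iff `u ↔ v` using the `R`-edges alone. -/
theorem conn_iff_restrict_R_of_not_conn (h : IsRootCut ends a₁ a₂ VR VS ER ES) {ω : Config E}
    (hQ : ¬ Conn ends (restrict ES ω) a₁ a₂) {u v : V} (hu : u ∈ VR ∪ {a₁, a₂})
    (hv : v ∈ VR ∪ {a₁, a₂}) : Conn ends ω u v ↔ Conn ends (restrict ER ω) u v :=
  conn_iff_restrict_of_not_conn h.symm hQ hu hv

/-- Membership in `Q` for a configuration. -/
lemma mem_avoidAll_iff {ω : Config E} :
    ω ∈ avoidAll ends a₂ {a₁} ↔ ¬ Conn ends ω a₂ a₁ := by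
  simp only [avoidAll, Set.mem_setOf_eq, Finset.mem_singleton, forall_eq]

/-- **`Q ∩ {u ↔ v} ∩ {u' ↔ v'}` factorises** for `u, v` on the `R`-side and `u', v'` on the
`S`-side. -/
theorem avoidAll_inter_conn_conn_eq (h : IsRootCut ends a₁ a₂ VR VS ER ES) {u v u' v' : V}
    (hu : u ∈ VR ∪ {a₁, a₂}) (hv : v ∈ VR ∪ {a₁, a₂}) (hu' : u' ∈ VS ∪ {a₁, a₂})
    (hv' : v' ∈ VS ∪ {a₁, a₂}) :
    avoidAll ends a₂ {a₁} ∩ (connEvent ends u v ∩ connEvent ends u' v') =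
      sideEvent ER (avoidAll ends a₂ {a₁} ∩ connEvent ends u v) ∩
        sideEvent ES (avoidAll ends a₂ {a₁} ∩ connEvent ends u' v') := by
  ext ω
  simp only [Set.mem_inter_iff, mem_sideEvent, mem_avoidAll_iff, mem_connEvent]
  constructor
  · rintro ⟨hQ, huv, huv'⟩
    obtain ⟨hR, hS⟩ := (not_conn_iff h).1 hQ
    have hR' : ¬ Conn ends (restrict ER ω) a₁ a₂ := fun hc => hR (conn_symm hc)
    have hS' : ¬ Conn ends (restrict ES ω) a₁ a₂ := fun hc => hS (conn_symm hc)
    exact ⟨⟨hR, (conn_iff_restrict_R_of_not_conn h hS' hu hv).1 huv⟩,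
      ⟨hS, (conn_iff_restrict_of_not_conn h hR' hu' hv').1 huv'⟩⟩
  · rintro ⟨⟨hR, huv⟩, ⟨hS, huv'⟩⟩
    exact ⟨(not_conn_iff h).2 ⟨hR, hS⟩, conn_mono (restrict_le ER ω) huv,
      conn_mono (restrict_le ES ω) huv'⟩

/-- **`Q ∩ {u ↔ v}` for `u, v` on the `R`-side** is `(Q_R ∩ {u ↔ v}_R) ∩ Q_S`. -/
theorem avoidAll_inter_conn_R_eq (h : IsRootCut ends a₁ a₂ VR VS ER ES) {u v : V}
    (hu : u ∈ VR ∪ {a₁, a₂}) (hv : v ∈ VR ∪ {a₁, a₂}) :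
    avoidAll ends a₂ {a₁} ∩ connEvent ends u v =
      sideEvent ER (avoidAll ends a₂ {a₁} ∩ connEvent ends u v) ∩
        sideEvent ES (avoidAll ends a₂ {a₁}) := by
  have key := avoidAll_inter_conn_conn_eq h hu hv (u' := a₁) (v' := a₁) (Or.inr (Or.inl rfl))
    (Or.inr (Or.inl rfl))
  have hrefl : ∀ ω : Config E, ω ∈ connEvent ends a₁ a₁ := fun ω => conn_refl ends ω a₁
  have h1 : connEvent ends u v ∩ connEvent ends a₁ a₁ = connEvent ends u v := by
    ext ω; simp only [Set.mem_inter_iff, hrefl, and_true]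
  have h2 : avoidAll ends a₂ {a₁} ∩ connEvent ends a₁ a₁ = avoidAll ends a₂ {a₁} := by
    ext ω; simp only [Set.mem_inter_iff, hrefl, and_true]
  rwa [h1, h2] at key

/-- **`Q ∩ {u ↔ v}` for `u, v` on the `S`-side** is `Q_R ∩ (Q_S ∩ {u ↔ v}_S)`. -/
theorem avoidAll_inter_conn_S_eq (h : IsRootCut ends a₁ a₂ VR VS ER ES) {u v : V}
    (hu : u ∈ VS ∪ {a₁, a₂}) (hv : v ∈ VS ∪ {a₁, a₂}) :
    avoidAll ends a₂ {a₁} ∩ connEvent ends u v =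
      sideEvent ER (avoidAll ends a₂ {a₁}) ∩
        sideEvent ES (avoidAll ends a₂ {a₁} ∩ connEvent ends u v) := by
  have key := avoidAll_inter_conn_conn_eq h (u := a₁) (v := a₁) (Or.inr (Or.inl rfl))
    (Or.inr (Or.inl rfl)) hu hv
  have hrefl : ∀ ω : Config E, ω ∈ connEvent ends a₁ a₁ := fun ω => conn_refl ends ω a₁
  have h1 : connEvent ends a₁ a₁ ∩ connEvent ends u v = connEvent ends u v := by
    ext ω; simp only [Set.mem_inter_iff, hrefl, true_and]
  have h2 : avoidAll ends a₂ {a₁} ∩ connEvent ends a₁ a₁ = avoidAll ends a₂ {a₁} := by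
    ext ω; simp only [Set.mem_inter_iff, hrefl, and_true]
  rwa [h1, h2] at key

section Probabilities

variable [Fintype E] [DecidableEq E] {R : Type*} [CommRing R] (p : E → R)

/-- **`P(Q, u ↔ v, u' ↔ v') = P_R(Q_R, u ↔ v) · P_S(Q_S, u' ↔ v')`.** -/
theorem prob_avoidAll_inter_conn_conn_eq_mul (h : IsRootCut ends a₁ a₂ VR VS ER ES) {u v u' v' : V}
    (hu : u ∈ VR ∪ {a₁, a₂}) (hv : v ∈ VR ∪ {a₁, a₂}) (hu' : u' ∈ VS ∪ {a₁, a₂})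
    (hv' : v' ∈ VS ∪ {a₁, a₂}) :
    prob p (avoidAll ends a₂ {a₁} ∩ (connEvent ends u v ∩ connEvent ends u' v')) =
      prob p (sideEvent ER (avoidAll ends a₂ {a₁} ∩ connEvent ends u v)) *
        prob p (sideEvent ES (avoidAll ends a₂ {a₁} ∩ connEvent ends u' v')) := by
  rw [avoidAll_inter_conn_conn_eq h hu hv hu' hv']
  exact prob_sideEvent_inter_eq_mul p h _ _

/-- **`P(Q, u ↔ v) = P_R(Q_R, u ↔ v) · P_S(Q_S)`** for `u, v` on the `R`-side. -/
theorem prob_avoidAll_inter_conn_R_eq_mul (h : IsRootCut ends a₁ a₂ VR VS ER ES) {u v : V}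
    (hu : u ∈ VR ∪ {a₁, a₂}) (hv : v ∈ VR ∪ {a₁, a₂}) :
    prob p (avoidAll ends a₂ {a₁} ∩ connEvent ends u v) =
      prob p (sideEvent ER (avoidAll ends a₂ {a₁} ∩ connEvent ends u v)) *
        prob p (sideEvent ES (avoidAll ends a₂ {a₁})) := by
  have key := prob_sideEvent_inter_eq_mul p h (avoidAll ends a₂ {a₁} ∩ connEvent ends u v)
    (avoidAll ends a₂ {a₁})
  rw [← avoidAll_inter_conn_R_eq h hu hv] at key
  exact key

/-- **`P(Q, u ↔ v) = P_R(Q_R) · P_S(Q_S, u ↔ v)`** for `u, v` on the `S`-side. -/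
theorem prob_avoidAll_inter_conn_S_eq_mul (h : IsRootCut ends a₁ a₂ VR VS ER ES) {u v : V}
    (hu : u ∈ VS ∪ {a₁, a₂}) (hv : v ∈ VS ∪ {a₁, a₂}) :
    prob p (avoidAll ends a₂ {a₁} ∩ connEvent ends u v) =
      prob p (sideEvent ER (avoidAll ends a₂ {a₁})) *
        prob p (sideEvent ES (avoidAll ends a₂ {a₁} ∩ connEvent ends u v)) := by
  have key := prob_sideEvent_inter_eq_mul p h (avoidAll ends a₂ {a₁})
    (avoidAll ends a₂ {a₁} ∩ connEvent ends u v)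
  rw [← avoidAll_inter_conn_S_eq h hu hv] at key
  exact key

end Probabilities

end Summit.Ventures.PercRepro2.RootCut
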